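import Literature.Geometry.Symplectic.JConvexMaximumPrinciple
import Literature.Topology.FourManifolds.MorseChartChangeInterior
import Literature.AlgebraicGeometry.HodgeTheory.LeviForm
import HarnessLib

/-!
# A `J`-convex function has Morse index `≤ 2` at every interior critical point

Topic `Literature/Geometry/Symplectic`; first brick of the discharge of the named fact
`Literature.Geometry.Symplectic.Gompf1998_thm13_indexLE_two` (`SteinHandlebodies.lean`;
Gompf 1998, Thm. 1.3 (Eliashberg 1990), compact case, "only if", condition (a): a compact Stein
domain is a 2-handlebody; Gompf, §0: a Stein manifold *"admits an 'exhausting strictly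
plurisubharmonic function,' which [...] can be assumed a Morse function"*, and Thm. 0.1 /
Thm. 1.3 (a): the induced handle decomposition has no handle of index above the complex
dimension).  The underlying pointwise fact: a strictly plurisubharmonic function on a complex
surface has no critical point of index `> 2`, because the Levi form is positive on every
complex line, whereas at a critical point of index `≥ 3` the Hessian is negative definite on a
real `3`-plane, which meets its image under `J` (a `3 + 3 > 4` count) in a complex line
(Milnor 1963, §7, proof of the Andreotti–Frankel/Lefschetz theorem, for the affine case;
Eliashberg 1990, §1; Cieliebak–Eliashberg 2012, §2–§3).

In the tree's chartwise formalism (`SteinDomain.lean`: Levi form `-dd^ℂφ_x(v, J_x v)`;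
`Morse.lean`: `morseIndex I f x = sigNeg` of the chart Hessian `mhessian I f x`) this file
proves:

* `sigNeg_le_two_of_pos_add` — linear algebra: if `Q(u) + Q(L u) > 0` for `u ≠ 0`, where
  `L` is a linear operator of `ℝ⁴` with `L² = -1`, then `sigNeg Q ≤ 2`; this is the case
  `dim = 4` of the tree's
  `Literature.AlgebraicGeometry.HodgeTheory.two_mul_sigNeg_le_finrank` (`LeviForm.lean`,
  Voisin II, Lemma 1.20 / Milnor 1963, §7: a negative definite subspace `N` is disjoint from
  `L N`, so `2 · sigNeg Q ≤ dim`), applied to the linear automorphism `L` (inverse `-L`);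
* `mhessian_apply_eq_of_isInteriorPoint`, `fderiv_comp_extChartAt_symm_eq_zero_of_isMCriticalPt`
  — at an interior point the chart Hessian is the second Fréchet derivative of
  `φ ∘ (extChartAt x₀)⁻¹`, and criticality reads `D(φ ∘ (extChartAt x₀)⁻¹)(c x₀) = 0`;
* `morseIndex_le_two_of_levi_pos` — **a smooth function which is strictly `J`-convex at an
  interior critical point `x₀` (`J` preserving smooth vector fields, `J_{x₀}² = -1`) has Morse
  index `≤ 2` there**, via the tree's Levi identity
  `Literature.Geometry.Symplectic.levi_apply_self_J_eq` (`JConvexMaximumPrinciple.lean`):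
  `-dd^ℂφ_{x₀}(u, J u) = D²f(u, u) + D²f(J u, J u)`, `f = φ ∘ c⁻¹`;
* `SteinStructure.morseIndex_le_two`, `SteinStructure.morseIndex_le_two_of_isMCriticalPt`,
  `SteinStructure.morseIndex_le_two_of_levi_pos`,
  `SteinStructure.isHandlebodyOfIndexLE_two_of_isMorseAdapted` — the corollaries for the
  `J`-convex function of a Stein structure, for any function strictly `J`-convex with respect to
  its `J`, and the handlebody form: an adapted Morse function strictly `J`-convex for `S.J`
  presents `W` as a 2-handlebody (`IsHandlebodyOfIndexLE 3 2 W`).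

Everything is **proved**; no definition, no named fact.  Companion use: the reduction
`Literature.Geometry.Symplectic.Eliashberg1990_steinFilling_sphere_three_of_forall_exists_isMorseAdapted`
(`SteinFillingSphereMorseReduction.lean`) of Eliashberg's filling theorem also consumes adapted
`J`-convex Morse functions, whose critical points this file constrains.

## References

* R. E. Gompf, *Handlebody construction of Stein surfaces*, Ann. of Math. 148 (1998), 619–693,
  Thm. 1.3 and §1. [Gompf1998]
* Ya. Eliashberg, *Topological characterization of Stein manifolds of dimension > 2*, Internat.
  J. Math. 1 (1990), 29–46, §1. [Eliashberg1990Stein]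
* K. Cieliebak, Ya. Eliashberg, *From Stein to Weinstein and back*, AMS Coll. Publ. 59 (2012),
  §2–§3 (`J`-convex functions, their critical points). [CieliebakEliashberg2012]
* J. Milnor, *Morse theory*, Ann. of Math. Studies 51 (1963), §2 (index), §7. [Milnor1963]
-/

noncomputable section

open scoped Manifold ContDiff Topology
open Set Function Filter

namespace Literature.Geometry.Symplectic

open Literature.Geometry.Kaehler Literature.Topology.FourManifolds

/-! ### Linear algebra: the negative index of a form positive on `L`-lines -/

section LinearAlgebra

/-- **On `ℝ⁴`: a quadratic form positive on every `L`-line (`L² = -1`) has negative index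
`≤ 2`.**  If `Q(u) + Q(L u) > 0` for all `u ≠ 0`, a subspace `N` on which `Q` is negative
definite is disjoint from `L N` (a non-zero `u = L w ∈ N ∩ L N`, `w ∈ N`, has
`L u = -w ∈ N ∖ {0}`, so `Q(u) + Q(L u) < 0`), hence `2 dim N ≤ 4`: the case `dim = 4` of the
tree's `Literature.AlgebraicGeometry.HodgeTheory.two_mul_sigNeg_le_finrank` (`LeviForm.lean`;
Milnor 1963, §7, proof of Thm. 7.2; Voisin II, Lemma 1.20), for the linear automorphism `L`
with inverse `-L`. [cite: Milnor1963, §7 (proof of Thm. 7.2)] -/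
theorem sigNeg_le_two_of_pos_add (Q : QuadraticForm ℝ (EuclideanSpace ℝ (Fin 4)))
    (L : EuclideanSpace ℝ (Fin 4) →ₗ[ℝ] EuclideanSpace ℝ (Fin 4)) (hL : ∀ u, L (L u) = -u)
    (hpos : ∀ u, u ≠ 0 → 0 < Q u + Q (L u)) : sigNeg Q ≤ 2 := by
  have h₁ : L.comp (-L) = LinearMap.id := LinearMap.ext fun u => by simp [hL]
  have h₂ : (-L).comp L = LinearMap.id := LinearMap.ext fun u => by simp [hL]
  set Le : EuclideanSpace ℝ (Fin 4) ≃ₗ[ℝ] EuclideanSpace ℝ (Fin 4) :=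
    LinearEquiv.ofLinear L (-L) h₁ h₂ with hLe
  have h := Literature.AlgebraicGeometry.HodgeTheory.two_mul_sigNeg_le_finrank Q Le
    (fun u hu => hpos u hu)
  rw [finrank_euclideanSpace_fin] at h
  omega

end LinearAlgebra

/-! ### The Hessian and criticality at an interior point, in the preferred chart -/

section Chart

variable {E H : Type*} [NormedAddCommGroup E] [NormedSpace ℝ E] [TopologicalSpace H]
  {I : ModelWithCorners ℝ E H} {M : Type*} [TopologicalSpace M] [ChartedSpace H M]

/-- At an interior point `x`, the chart Hessian `mhessian I f x` evaluated on `(v, w)` is the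
second Fréchet derivative of `f ∘ (extChartAt I x)⁻¹` at `extChartAt I x x` (the tree's
`mhessian_apply_eq_fderiv_fderiv_of_isInteriorPoint'`, `MorseChartChangeInterior.lean`, with
`writtenInExtChartAt` unfolded). [cite: Milnor1963, §2] -/
theorem mhessian_apply_eq_of_isInteriorPoint {f : M → ℝ} {x : M} (hx : I.IsInteriorPoint x)
    (v w : E) :
    mhessian I f x v w = fderiv ℝ (fderiv ℝ (f ∘ (extChartAt I x).symm)) (extChartAt I x x) v w := by
  rw [mhessian_apply_eq_fderiv_fderiv_of_isInteriorPoint' hx, writtenInExtChartAt_eq_comp_extend_symm]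
  rfl

/-- At an interior critical point `x` of a `C¹` function `f`, `D(f ∘ (extChartAt I x)⁻¹)`
vanishes at `extChartAt I x x`. [cite: Milnor1963, §2] -/
theorem fderiv_comp_extChartAt_symm_eq_zero_of_isMCriticalPt {f : M → ℝ} {x : M}
    (hf : MDifferentiableAt I 𝓘(ℝ, ℝ) f x) (hx : I.IsInteriorPoint x) (hcrit : IsMCriticalPt I f x) :
    fderiv ℝ (f ∘ (extChartAt I x).symm) (extChartAt I x x) = 0 := by
  have h : mfderiv I 𝓘(ℝ, ℝ) f x = 0 := hcrit
  rw [hf.mfderiv, fderivWithin_of_mem_nhds (range_mem_nhds_isInteriorPoint hx),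
    writtenInExtChartAt_eq_comp_extend_symm] at h
  exact h

end Chart

/-! ### `J`-convex functions have Morse index `≤ 2` at interior critical points -/

section Levi

variable {W : Type*} [TopologicalSpace W] [T2Space W] [ChartedSpace (EuclideanHalfSpace 4) W]
  [IsManifold (𝓡∂ 4) ∞ W] {J : (x : W) → (EuclideanSpace ℝ (Fin 4) →L[ℝ] EuclideanSpace ℝ (Fin 4))}

/-- **A strictly `J`-convex function has Morse index `≤ 2` at an interior critical point**
(Gompf 1998, Thm. 1.3 (a) / §1; Eliashberg 1990, §1; Milnor 1963, §7).  Tree rendering: `φ`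
smooth, `J` preserving smooth vector fields with `J_{x₀}² = -1`, `x₀` an interior critical
point of `φ` at which `-dd^ℂφ_{x₀}(v, J v) > 0` for `v ≠ 0`; then `morseIndex (𝓡∂ 4) φ x₀ ≤ 2`.
Proof: the chart Hessian `H = D²(φ ∘ c⁻¹)(c x₀)` satisfies
`H(u, u) + H(J u, J u) = -dd^ℂφ_{x₀}(u, J u) > 0` (`levi_apply_self_J_eq`), so by
`sigNeg_le_two_of_pos_add` its negative index of inertia is `≤ 2`. [cite: Gompf1998, Thm. 1.3 (a) and §1] -/
theorem morseIndex_le_two_of_levi_pos (hJ : PreservesSmoothFields J) {φ : W → ℝ}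
    (hφ : ContMDiff (𝓡∂ 4) 𝓘(ℝ, ℝ) ∞ φ) {x₀ : W} (hx₀ : (𝓡∂ 4).IsInteriorPoint x₀)
    (hJsq : ∀ v : EuclideanSpace ℝ (Fin 4), J x₀ (J x₀ v) = -v)
    (hconv : ∀ v : EuclideanSpace ℝ (Fin 4), v ≠ 0 →
      0 < -(mextDeriv (dComplex J φ) x₀ ![v, J x₀ v]))
    (hcrit : IsMCriticalPt (𝓡∂ 4) φ x₀) :
    morseIndex (𝓡∂ 4) φ x₀ ≤ 2 := by
  have hd : MDifferentiableAt (𝓡∂ 4) 𝓘(ℝ, ℝ) φ x₀ := (hφ x₀).mdifferentiableAt (by simp)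
  have hcrit' := fderiv_comp_extChartAt_symm_eq_zero_of_isMCriticalPt hd hx₀ hcrit
  unfold morseIndex
  refine sigNeg_le_two_of_pos_add _ (J x₀ : EuclideanSpace ℝ (Fin 4) →ₗ[ℝ] EuclideanSpace ℝ (Fin 4))
    (fun u => hJsq u) fun u hu => ?_
  have key := levi_apply_self_J_eq hJ hφ hx₀ hJsq hcrit' u
  rw [LinearMap.BilinMap.toQuadraticMap_apply, LinearMap.BilinMap.toQuadraticMap_apply,
    ContinuousLinearMap.coe_coe, mhessian_apply_eq_of_isInteriorPoint hx₀,
    mhessian_apply_eq_of_isInteriorPoint hx₀, ← key]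
  exact hconv u hu

/-- **All interior critical points of a strictly `J`-convex function have index `≤ 2`**
(global form: `J² = -1` everywhere, `φ` strictly `J`-convex everywhere). [cite: Gompf1998, Thm. 1.3 (a) and §1] -/
theorem morseIndex_le_two_of_forall_levi_pos (hJ : PreservesSmoothFields J)
    (hJsq : ∀ x (v : EuclideanSpace ℝ (Fin 4)), J x (J x v) = -v) {φ : W → ℝ}
    (hφ : ContMDiff (𝓡∂ 4) 𝓘(ℝ, ℝ) ∞ φ)
    (hconv : ∀ x (v : EuclideanSpace ℝ (Fin 4)), v ≠ 0 →
      0 < -(mextDeriv (dComplex J φ) x ![v, J x v]))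
    {x₀ : W} (hx₀ : (𝓡∂ 4).IsInteriorPoint x₀) (hcrit : IsMCriticalPt (𝓡∂ 4) φ x₀) :
    morseIndex (𝓡∂ 4) φ x₀ ≤ 2 :=
  morseIndex_le_two_of_levi_pos hJ hφ hx₀ (hJsq x₀) (hconv x₀) hcrit

/-- **Critical points of a boundary-regular strictly `J`-convex function have index `≤ 2`**:
if `φ` has no critical point on `∂W`, every critical point is interior and the previous
theorem applies. [cite: Gompf1998, Thm. 1.3 (a) and §1] -/
theorem morseIndex_le_two_of_forall_levi_pos_of_boundaryRegular (hJ : PreservesSmoothFields J)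
    (hJsq : ∀ x (v : EuclideanSpace ℝ (Fin 4)), J x (J x v) = -v) {φ : W → ℝ}
    (hφ : ContMDiff (𝓡∂ 4) 𝓘(ℝ, ℝ) ∞ φ)
    (hconv : ∀ x (v : EuclideanSpace ℝ (Fin 4)), v ≠ 0 →
      0 < -(mextDeriv (dComplex J φ) x ![v, J x v]))
    (hbd : ∀ x, (𝓡∂ 4).IsBoundaryPoint x → ¬ IsMCriticalPt (𝓡∂ 4) φ x)
    {x₀ : W} (hcrit : IsMCriticalPt (𝓡∂ 4) φ x₀) :
    morseIndex (𝓡∂ 4) φ x₀ ≤ 2 := by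
  have hx₀ : (𝓡∂ 4).IsInteriorPoint x₀ :=
    ((𝓡∂ 4).isInteriorPoint_iff_not_isBoundaryPoint x₀).2 fun hb => hbd x₀ hb hcrit
  exact morseIndex_le_two_of_forall_levi_pos hJ hJsq hφ hconv hx₀ hcrit

end Levi

/-! ### Stein structures -/

section Stein

variable {W : Type*} [TopologicalSpace W] [T2Space W] [ChartedSpace (EuclideanHalfSpace 4) W]
  [IsManifold (𝓡∂ 4) ∞ W] [CompactSpace W]

namespace SteinStructure

/-- **The `J`-convex function of a Stein structure has Morse index `≤ 2` at every interior
critical point** (Gompf 1998, Thm. 1.3 (a); Eliashberg 1990). [cite: Gompf1998, Thm. 1.3 (a) and §1] -/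
theorem morseIndex_le_two (S : SteinStructure W) {x : W} (hx : (𝓡∂ 4).IsInteriorPoint x)
    (hcrit : IsMCriticalPt (𝓡∂ 4) S.φ x) : morseIndex (𝓡∂ 4) S.φ x ≤ 2 :=
  morseIndex_le_two_of_levi_pos S.preservesSmoothFields S.φ_smooth hx (S.J_sq x)
    (fun v hv => S.convex x v hv) hcrit

/-- **Every critical point of the `J`-convex function of a Stein structure has index `≤ 2`**:
the boundary is a regular level (`SteinStructure.regular`), so critical points are interior.
[cite: Gompf1998, Thm. 1.3 (a) and §1] -/
theorem morseIndex_le_two_of_isMCriticalPt (S : SteinStructure W) {x : W}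
    (hcrit : IsMCriticalPt (𝓡∂ 4) S.φ x) : morseIndex (𝓡∂ 4) S.φ x ≤ 2 :=
  morseIndex_le_two_of_forall_levi_pos_of_boundaryRegular S.preservesSmoothFields S.J_sq
    S.φ_smooth (fun x v hv => S.convex x v hv) (fun x hx h => S.regular x hx h) hcrit

/-- **Any smooth function strictly `J`-convex for the `J` of a Stein structure has Morse index
`≤ 2` at its interior critical points** (the form consumed by the discharge of
`Gompf1998_thm13_indexLE_two`, applied to a `J`-convex Morse perturbation of `S.φ`).
[cite: Gompf1998, Thm. 1.3 (a) and §1] -/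
theorem morseIndex_le_two_of_levi_pos (S : SteinStructure W) {g : W → ℝ}
    (hg : ContMDiff (𝓡∂ 4) 𝓘(ℝ, ℝ) ∞ g)
    (hconv : ∀ x (v : EuclideanSpace ℝ (Fin 4)), v ≠ 0 →
      0 < -(mextDeriv (dComplex S.J g) x ![v, S.J x v]))
    {x : W} (hx : (𝓡∂ 4).IsInteriorPoint x) (hcrit : IsMCriticalPt (𝓡∂ 4) g x) :
    morseIndex (𝓡∂ 4) g x ≤ 2 :=
  morseIndex_le_two_of_forall_levi_pos S.preservesSmoothFields S.J_sq hg hconv hx hcrit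

/-- **An adapted Morse function strictly `J`-convex for the `J` of a Stein structure presents
`W` as a 2-handlebody** (`Literature.Topology.FourManifolds.IsHandlebodyOfIndexLE 3 2 W`): its
critical points are interior (it is regular on `∂W`), hence of index `≤ 2`.
[cite: Gompf1998, Thm. 1.3 (a) and §1] -/
theorem isHandlebodyOfIndexLE_two_of_isMorseAdapted (S : SteinStructure W) {g : W → ℝ}
    (hg : IsMorseAdapted (𝓡∂ 4) g)
    (hconv : ∀ x (v : EuclideanSpace ℝ (Fin 4)), v ≠ 0 →
      0 < -(mextDeriv (dComplex S.J g) x ![v, S.J x v])) :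
    IsHandlebodyOfIndexLE 3 2 W :=
  ⟨g, hg, fun _ hz => morseIndex_le_two_of_forall_levi_pos_of_boundaryRegular
    S.preservesSmoothFields S.J_sq hg.isMorse.contMDiff hconv (fun x hx => (hg.2.1 x hx).2) hz⟩

end SteinStructure

end Stein

end Literature.Geometry.Symplectic

end
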